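import Summits.BirchSwinnertonDyer.Rank1Residual.O5.FlexNFIsogenousCaseNZeroCells
import Summits.BirchSwinnertonDyer.Rank1Residual.O5.FlexNormalFormCaseNValLaw
import HarnessLib

/-!
# O5 — T31 Case N v2 `FlexNFIsogenousCaseNKodairaValLawThree` PROVED AS TYPED (`_holds`): the Kodaira symbol and conductor
# exponent at `3` of `isoQ b A₃ 0 ≅ E/⟨P₀⟩` (`A₃ ≡ 1 (mod 3)`, `b³ ≠ A₃`) are `isoNAt b A₃ (v₃(b³ − A₃))`; plus the v1 node's
# conclusion on every pair with `v₃(b³ − A₃) ≤ 64`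
# (cell `b2b-bsdres`, team n1011, ROW T-FLEX-KOD FILE 4c / RESEAT-TRIGGER T5 (cc-typer-5 (c28) p334541); seat
#  `b2b-bsdres-n1011-p18` GEN 14; theorems only)

HONEST FRAMING (cell `b2b-bsdres`, run/shared/lean/b2b/bsd-rank1-residual/, verbatim in every file): the
goal of the cell is to DELETE the COMBINATION-SHAPED residual classes of the Birch–Swinnerton-Dyer formula
for ALL analytic-rank `≤ 1` elliptic curves over `ℚ` — "full BSD formula for every rank `≤ 1` curve in
class `C`" assembled STRICTLY from published theorems — so that the rank-`≤ 1` remainder becomes exactly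
the CONSTRUCTION-SHAPED classes, which are TYPED (missing-input `Prop`s), NOT attempted. This is not
"finishing BSD". Lane CLASS-CLOSURE / O5 (O5 OPEN): research route; census output (P-K20) is EVIDENCE,
never a Literature fact; nothing is booked; no mark of `RESIDUAL-MAP.md` moves. This file: THEOREMS ONLY
(no definition, no named fact, no `@[conjecture]` node, no `sorry`; net named-fact debt `0`); nothing of
cc-typer-5's / o5-r1's files is edited; a `_holds` theorem for a conjecture node closes NO pair and moves NO mark.
[cite: SilvermanATAEC1994, IV.9.4 and IV.11.1]
-/

open scoped NumberField

open IsDedekindDomain Rat.HeightOneSpectrum WeierstrassCurve NumberField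
  Literature.NumberTheory.EllipticCurves Literature.NumberTheory.DiophantineGeometry
  Summit.BirchSwinnertonDyer.Rank1Residual

namespace Summit.BirchSwinnertonDyer.Rank1Residual.O5.FlexNormalForm.Isogenous

/-- Ogg's formula is the tree's DEFINITION of `conductorExponent`. [cite: SilvermanATAEC1994, IV.11.1] -/
private theorem condExp_of_pair' {W : WeierstrassCurve ℚ} {T : KodairaSymbol} {n : ℕ}
    (h : W.kodairaSymbolAt (Additive.placeOf 3) = T ∧ W.ordMinimalDiscriminant (Additive.placeOf 3) = n) :
    W.conductorExponent (Additive.placeOf 3) = n + 1 - T.numComponents := by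
  unfold WeierstrassCurve.conductorExponent WeierstrassCurve.numComponentsAt
  rw [h.1, h.2]

/-- **T31 Case N v2 PROVED AS TYPED: `FlexNFIsogenousCaseNKodairaValLawThree` holds** (cells `w = 0` (FILE 4b), `w ∈ {1,2,3}`
(FILE 4a), tail `w ≥ 4` (F3⁻), read through Ogg's formula). [cite: SilvermanATAEC1994, IV.9.4 and IV.11.1] -/
theorem flexNFIsogenousCaseNKodairaValLawThree_holds : FlexNFIsogenousCaseNKodairaValLawThree := by
  intro b A₃ hA hne
  have hx : b ^ 3 - A₃ ≠ 0 := sub_ne_zero.mpr hne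
  obtain ⟨h11, h1n, -⟩ := FlexNormalForm.three_pow_dvd_cube_sub b A₃ hA
  by_cases hb : b % 3 = 1
  · by_cases ha9 : A₃ % 9 = 1
    · obtain ⟨hM, hM'⟩ := FlexNormalForm.pexact_padicValInt_three hx
      have hw2 : 2 ≤ padicValInt 3 (b ^ 3 - A₃) := by
        by_contra hlt
        exact hM' ((pow_dvd_pow (3 : ℤ) (by omega : padicValInt 3 (b ^ 3 - A₃) + 1 ≤ 2)).trans (h11 hb ha9))
      rcases Nat.lt_or_ge (padicValInt 3 (b ^ 3 - A₃)) 4 with hlt | hge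
      · have hw : padicValInt 3 (b ^ 3 - A₃) = 2 ∨ padicValInt 3 (b ^ 3 - A₃) = 3 := by omega
        have hp := kodairaSymbolAt_and_ord_isoQ_zero_mid b A₃ hA hb hw hM hM'
        rcases hw with h2 | h3
        · rw [h2] at hp ⊢
          have hc : (isoNAt b A₃ 2).kod = .II ∧ (isoNAt b A₃ 2).f = 3 := by
            simp [isoNAt, hb, ha9, oggF, KodairaSymbol.numComponents]
          refine ⟨by rw [hp.1, hc.1]; rfl, ?_⟩
          rw [condExp_of_pair' hp, hc.2]; rfl
        · rw [h3] at hp ⊢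
          have hc : (isoNAt b A₃ 3).kod = .Istar 0 ∧ (isoNAt b A₃ 3).f = 2 := by
            simp [isoNAt, hb, ha9, oggF, KodairaSymbol.numComponents]
          refine ⟨by rw [hp.1, hc.1]; rfl, ?_⟩
          rw [condExp_of_pair' hp, hc.2]; rfl
      · obtain ⟨hK, -, hf⟩ := kodairaSymbolAt_and_ord_isoQ_zero_tail b A₃ hA hb hge hM hM'
        have hw2' : padicValInt 3 (b ^ 3 - A₃) ≠ 2 := by omega
        have hw3' : padicValInt 3 (b ^ 3 - A₃) ≠ 3 := by omega
        have hc : (isoNAt b A₃ (padicValInt 3 (b ^ 3 - A₃))).kod = .Istar (3 * (padicValInt 3 (b ^ 3 - A₃) - 3)) ∧ (isoNAt b A₃ (padicValInt 3 (b ^ 3 - A₃))).f = 2 := by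
          simp [isoNAt, hb, ha9, hw2', hw3', oggF]
        refine ⟨?_, by rw [hf, hc.2]⟩
        rw [hK, hc.1]; congr 1; omega
    · obtain ⟨hM, hM'⟩ := h1n hb ha9
      have hp := kodairaSymbolAt_and_ord_isoQ_zero_one b A₃ hA hM hM'
      have hc : (isoNAt b A₃ (padicValInt 3 (b ^ 3 - A₃))).kod = .IIstar ∧ (isoNAt b A₃ (padicValInt 3 (b ^ 3 - A₃))).f = 4 := by
        simp [isoNAt, hb, ha9, oggF, KodairaSymbol.numComponents]
      refine ⟨by rw [hp.1, hc.1], ?_⟩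
      rw [condExp_of_pair' hp, hc.2]; rfl
  · have hb' : b % 3 = 0 ∨ b % 3 = 2 := by omega
    have ha' : A₃ % 9 = 1 ∨ A₃ % 9 = 4 ∨ A₃ % 9 = 7 := by omega
    have key : ∀ {T : KodairaSymbol},
        ((isoQ b A₃ 0).kodairaSymbolAt (Additive.placeOf 3) = T ∧
          (isoQ b A₃ 0).ordMinimalDiscriminant (Additive.placeOf 3) = 9) →
        ((isoNAt b A₃ (padicValInt 3 (b ^ 3 - A₃))).kod = T ∧ (isoNAt b A₃ (padicValInt 3 (b ^ 3 - A₃))).f = 9 + 1 - T.numComponents) →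
        (isoQ b A₃ 0).kodairaSymbolAt (Additive.placeOf 3) = (isoNAt b A₃ (padicValInt 3 (b ^ 3 - A₃))).kod ∧
          (isoQ b A₃ 0).conductorExponent (Additive.placeOf 3) = (isoNAt b A₃ (padicValInt 3 (b ^ 3 - A₃))).f := by
      rintro T hp hc
      exact ⟨by rw [hp.1, hc.1], by rw [condExp_of_pair' hp, hc.2]⟩
    rcases hb' with h0 | h2 <;> rcases ha' with h1 | h4 | h7
    · exact key (kodairaSymbolAt_and_ord_isoQ_zero_w0_b0_a1 b A₃ h0 h1)
        (by simp [isoNAt, h0, h1, oggF, KodairaSymbol.numComponents])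
    · exact key (kodairaSymbolAt_and_ord_isoQ_zero_w0_b0_a4 b A₃ h0 h4)
        (by simp [isoNAt, h0, h4, oggF, KodairaSymbol.numComponents])
    · exact key (kodairaSymbolAt_and_ord_isoQ_zero_w0_b0_a7 b A₃ h0 h7)
        (by simp [isoNAt, h0, h7, oggF, KodairaSymbol.numComponents])
    · exact key (kodairaSymbolAt_and_ord_isoQ_zero_w0_b2_a1 b A₃ h2 h1)
        (by simp [isoNAt, h2, h1, oggF, KodairaSymbol.numComponents])
    · exact key (kodairaSymbolAt_and_ord_isoQ_zero_w0_b2_a4 b A₃ h2 h4)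
        (by simp [isoNAt, h2, h4, oggF, KodairaSymbol.numComponents])
    · exact key (kodairaSymbolAt_and_ord_isoQ_zero_w0_b2_a7 b A₃ h2 h7)
        (by simp [isoNAt, h2, h7, oggF, KodairaSymbol.numComponents])


/-- **T31-N on every `(b, A₃)` whose `3`-adic order `v₃(b³ − A₃)` fits in the typer's fuel (`≤ 64`)**: the typed
conclusion of `FlexNFIsogenousCaseNKodairaLawThree` holds. [cite: SilvermanATAEC1994, IV.9.4 and IV.11.1] -/
theorem flexNFIsogenousCaseNKodairaLawThree_of_padicValInt_le (b A₃ : ℤ) (hA : A₃ % 3 = 1) (hne : b ^ 3 ≠ A₃)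
    (h64 : padicValInt 3 (b ^ 3 - A₃) ≤ 64) :
    (isoQ b A₃ 0).kodairaSymbolAt (Additive.placeOf 3) = (isoN b A₃).kod ∧
      (isoQ b A₃ 0).conductorExponent (Additive.placeOf 3) = (isoN b A₃).f := by
  have hx : b ^ 3 - A₃ ≠ 0 := sub_ne_zero.mpr hne
  obtain ⟨h11, h1n, -⟩ := FlexNormalForm.three_pow_dvd_cube_sub b A₃ hA
  by_cases hb : b % 3 = 1
  · by_cases ha9 : A₃ % 9 = 1
    · obtain ⟨hM, hM'⟩ := FlexNormalForm.pexact_padicValInt_three hx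
      have hw2 : 2 ≤ padicValInt 3 (b ^ 3 - A₃) := by
        by_contra hlt
        exact hM' ((pow_dvd_pow (3 : ℤ) (by omega : padicValInt 3 (b ^ 3 - A₃) + 1 ≤ 2)).trans (h11 hb ha9))
      have hord3 : ord3 64 (b ^ 3 - A₃) = padicValInt 3 (b ^ 3 - A₃) :=
        FlexNormalForm.ord3_eq_padicValInt 64 _ hx h64
      rcases Nat.lt_or_ge (padicValInt 3 (b ^ 3 - A₃)) 4 with hlt | hge
      · have hw : padicValInt 3 (b ^ 3 - A₃) = 2 ∨ padicValInt 3 (b ^ 3 - A₃) = 3 := by omega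
        have hp := kodairaSymbolAt_and_ord_isoQ_zero_mid b A₃ hA hb hw hM hM'
        rcases hw with h2 | h3
        · rw [h2] at hp hord3
          have hc : (isoN b A₃).kod = .II ∧ (isoN b A₃).f = 3 := by
            simp [isoN, hb, ha9, hord3, oggF, KodairaSymbol.numComponents]
          refine ⟨by rw [hp.1, hc.1]; rfl, ?_⟩
          rw [condExp_of_pair' hp, hc.2]; rfl
        · rw [h3] at hp hord3
          have hc : (isoN b A₃).kod = .Istar 0 ∧ (isoN b A₃).f = 2 := by
            simp [isoN, hb, ha9, hord3, oggF, KodairaSymbol.numComponents]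
          refine ⟨by rw [hp.1, hc.1]; rfl, ?_⟩
          rw [condExp_of_pair' hp, hc.2]; rfl
      · obtain ⟨hK, -, hf⟩ := kodairaSymbolAt_and_ord_isoQ_zero_tail b A₃ hA hb hge hM hM'
        have hw2' : padicValInt 3 (b ^ 3 - A₃) ≠ 2 := by omega
        have hw3' : padicValInt 3 (b ^ 3 - A₃) ≠ 3 := by omega
        have hc : (isoN b A₃).kod = .Istar (3 * (padicValInt 3 (b ^ 3 - A₃) - 3)) ∧ (isoN b A₃).f = 2 := by
          simp [isoN, hb, ha9, hord3, hw2', hw3', oggF]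
        refine ⟨?_, by rw [hf, hc.2]⟩
        rw [hK, hc.1]; congr 1; omega
    · obtain ⟨hM, hM'⟩ := h1n hb ha9
      have hp := kodairaSymbolAt_and_ord_isoQ_zero_one b A₃ hA hM hM'
      have hc : (isoN b A₃).kod = .IIstar ∧ (isoN b A₃).f = 4 := by
        simp [isoN, hb, ha9, oggF, KodairaSymbol.numComponents]
      refine ⟨by rw [hp.1, hc.1], ?_⟩
      rw [condExp_of_pair' hp, hc.2]; rfl
  · have hb' : b % 3 = 0 ∨ b % 3 = 2 := by omega
    have ha' : A₃ % 9 = 1 ∨ A₃ % 9 = 4 ∨ A₃ % 9 = 7 := by omega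
    have key : ∀ {T : KodairaSymbol},
        ((isoQ b A₃ 0).kodairaSymbolAt (Additive.placeOf 3) = T ∧
          (isoQ b A₃ 0).ordMinimalDiscriminant (Additive.placeOf 3) = 9) →
        ((isoN b A₃).kod = T ∧ (isoN b A₃).f = 9 + 1 - T.numComponents) →
        (isoQ b A₃ 0).kodairaSymbolAt (Additive.placeOf 3) = (isoN b A₃).kod ∧
          (isoQ b A₃ 0).conductorExponent (Additive.placeOf 3) = (isoN b A₃).f := by
      rintro T hp hc
      exact ⟨by rw [hp.1, hc.1], by rw [condExp_of_pair' hp, hc.2]⟩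
    rcases hb' with h0 | h2 <;> rcases ha' with h1 | h4 | h7
    · exact key (kodairaSymbolAt_and_ord_isoQ_zero_w0_b0_a1 b A₃ h0 h1)
        (by simp [isoN, h0, h1, oggF, KodairaSymbol.numComponents])
    · exact key (kodairaSymbolAt_and_ord_isoQ_zero_w0_b0_a4 b A₃ h0 h4)
        (by simp [isoN, h0, h4, oggF, KodairaSymbol.numComponents])
    · exact key (kodairaSymbolAt_and_ord_isoQ_zero_w0_b0_a7 b A₃ h0 h7)
        (by simp [isoN, h0, h7, oggF, KodairaSymbol.numComponents])
    · exact key (kodairaSymbolAt_and_ord_isoQ_zero_w0_b2_a1 b A₃ h2 h1)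
        (by simp [isoN, h2, h1, oggF, KodairaSymbol.numComponents])
    · exact key (kodairaSymbolAt_and_ord_isoQ_zero_w0_b2_a4 b A₃ h2 h4)
        (by simp [isoN, h2, h4, oggF, KodairaSymbol.numComponents])
    · exact key (kodairaSymbolAt_and_ord_isoQ_zero_w0_b2_a7 b A₃ h2 h7)
        (by simp [isoN, h2, h7, oggF, KodairaSymbol.numComponents])

/-! `not_flexNFIsogenousCaseNKodairaLawThree` is in `O5/FlexNFCaseNTailThree.lean` (F3⁻). -/

end Summit.BirchSwinnertonDyer.Rank1Residual.O5.FlexNormalForm.Isogenous
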